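import Summits.ABC.StewartYu.PadicG3TwoFrameSatData
import Summits.ABC.StewartYu.SatBasisReduced
import HarnessLib

/-!
# Cell abc-stewartyu, WP-L.P (both parities): the reduced saturated basis kit `SatKitFull n` HOLDS
# (discharge of the line stub `stub_satKitTwo` of crux r4 `PadicCoreTwoRat`, stmt-ABC-20504)

`Summits/ABC/StewartYu/SatKitFullHolds.lean` — cell `abc-stewartyu` (HOME `run/shared/lean/pub/abc-stewartyu/`), route
`YuMatveevShapeRat`, seat p3 (g9).  Theorems only.  `SatKitFull n` (`PadicG3TwoFrameSatData`, = p2's `SatKit` text with the Kummer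
line as full saturation, plan R33 (i)) from p1's ✓ `SatBasisReduced.exists_reduced_satFrame` (which already carries the
`∀ q` saturation conjunct and the SHARPER size lines `|C| ≤ (n−1)!·N`, `h(θᵢ) ≤ Σ h(aⱼ)`, `N ≤ ∏ 2h(aⱼ)/log 2`) by weakening:
`2h ≤ 2·max(1,h)`, `(n−1)! ≤ n!`, `h ≤ max(1,h)`.

* **`satKitFull_holds : ∀ n, SatKitFull n`**;
* `stub_satKitTwo_holds : ∀ d, 1 ≤ d → SatKitFull (d+1)` — literally the statement `Sig.stub_satKitTwo` of line `padic-two-sat-frame`.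

WHAT THIS IS NOT: no record; no crux moves by itself (the line's other stub is the record's supply).

References: J. W. S. Cassels, Geometry of Numbers, Ch. I §2.2; Yu. V. Nesterenko, LNM 1819 (2003) §3.5, §4.3 Cor 4.5.
-/

noncomputable section

open Finset
open scoped Matrix Nat

namespace Summit.ABC.StewartYu

/-- **The reduced saturated basis kit holds at every rank** (from p1's `SatBasisReduced.exists_reduced_satFrame`).
[cite: Nesterenko2003, §3.5 and §4.3 Cor 4.5; shape only] -/
theorem satKitFull_holds (n : ℕ) : SatKitFull n := by
  intro a ha hind
  obtain ⟨θ, U, C, N, hpos, hθind, hsat, _h2K, hN, hU, hC, hUC, hCU, _hdet, hNle, _hU0, hUcol, hCbnd, hhθ, _hunit⟩ :=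
    SatBasisReduced.exists_reduced_satFrame a ha hind
  refine ⟨θ, U, C, N, hpos, hθind, hsat, hN, hU, hC, hUC, hCU, ?_, hUcol, ?_, ?_⟩
  · -- `∏ 2h/log 2 ≤ ∏ 2·max(1,h)/log 2`
    refine hNle.trans (Finset.prod_le_prod (fun j _ => ?_) (fun j _ => ?_))
    · have : 0 ≤ Height.logHeight₁ (a j) := Height.zero_le_logHeight₁ _
      have hl : 0 < Real.log 2 := Real.log_pos one_lt_two
      positivity
    · have hl : 0 < Real.log 2 := Real.log_pos one_lt_two
      exact div_le_div_of_nonneg_right (by linarith [le_max_right 1 (Height.logHeight₁ (a j))]) hl.le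
  · -- `(n−1)!·N ≤ n!·N`
    intro j k
    refine (hCbnd j k).trans ?_
    have h1 : (((n - 1) ! : ℕ) : ℤ) ≤ ((n ! : ℕ) : ℤ) := by
      exact_mod_cast Nat.factorial_le (Nat.sub_le n 1)
    have hN0 : (0 : ℤ) ≤ N := by positivity
    calc (((n - 1) ! : ℕ) : ℤ) * N ≤ ((n ! : ℕ) : ℤ) * N := mul_le_mul_of_nonneg_right h1 hN0
      _ = ((n ! : ℕ) : ℤ) * N := rfl
  · intro i
    exact (hhθ i).trans (Finset.sum_le_sum fun j _ => le_max_right _ _)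

/-- **The line stub `stub_satKitTwo` of crux r4 (`PadicCoreTwoRat`), discharged**: `∀ d ≥ 1, SatKitFull (d+1)`.
[cite: Nesterenko2003, §4.3 Cor 4.5; shape only] -/
theorem stub_satKitTwo_holds : ∀ d : ℕ, 1 ≤ d → SatKitFull (d + 1) := fun d _ => satKitFull_holds (d + 1)

end Summit.ABC.StewartYu

end
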